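import Mathlib
import Literature.Probability.Percolation.BlockResampling
import Summits.CriticalPhenomena.CardyFormulaZ2.Theorems.CardySelfRefinementGradientComparabilityStubDcZeroHalfGeSumPivotal
import Summits.CriticalPhenomena.CardyFormulaZ2.Theorems.CardySelfRefinementGradientComparabilityStubExistsPivotalOfNondegenerate
import HarnessLib

/-!
# Sections of the joint crossing event given a layer of edges: disintegration of pivotality

Crux `stmt-CriticalPhenomena-10269`
(`Summit.CriticalPhenomena.CardyFormulaZ2.Theses.CardySelfRefinement.GradientComparability`),
line **Sketch**, helper file of the stub `stub_bulkPivotalSum_diverges` (D3-bulk: the expected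
number of BULK edges pivotal for the localised joint crossing event `Aloc m F η` of a quad family
diverges as the mesh `η → 0⁺`).  Vocabulary (`Aloc`, `window`) from `CardySelfRefinementDefs`.

## Mathematics

Let `W` be the (finite) window, `L ⊆ W` a "layer" of edges and `B = W ∖ L` the "bulk".  For a
layer configuration `ξ ⊆ L` the **section** of `Aloc` is the event
`A^ξ = {ω | (ω ∖ L) ∪ ξ ∈ Aloc}`: it is increasing (`isUpperSet_section`) and determined by `B`
(`determinedBy_section`), and for `e ∉ L` the edge `e` is pivotal for `A^ξ` at `ω` iff it is
pivotal for `Aloc` at `(ω ∖ L) ∪ ξ` (`isPivotal_section_iff`).  Finite Fubini over the block `L`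
(`integral_eq_sum_powerset`, independence of the edges of `L` from the others under `P_{1/2}`)
gives the disintegration

  `P(e pivotal for Aloc) = Σ_{ξ ⊆ L} P(ω ∩ L = ξ) · P(e pivotal for A^ξ)`

(`real_isPivotal_eq_sum_powerset`, registered sub-goal).  Also: for ANY increasing event `E`
determined by a finite set `B` of lattice edges, `0 < P(E)(1 − P(E))` forces
`Σ_{e∈B} P(e pivotal for E)² > 0` (`sum_sq_real_isPivotal_pos`; the discrete intermediate value
step of D0, `exists_insert_mem_of_union_mem`, and the positivity of finite cylinders).
-/

noncomputable section

namespace Summit.CriticalPhenomena.CardyFormulaZ2.Theorems.CardySelfRefinement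

open scoped Topology
open Filter Set MeasureTheory
open Literature.Probability.LatticeModels Literature.Probability.Percolation
open Literature.Probability.Percolation.QuadCrossing
open Summit.CriticalPhenomena.CardyFormulaZ2.Theses.CardySelfRefinement

/-! ## Positivity of the pivotal sum of a non-degenerate increasing local event -/

/-- **Non-degeneracy gives a pivotal edge** (D0 for an arbitrary increasing event `E` determined
by a finite set `B` of lattice edges): if `0 < P_{1/2}(E)(1 − P_{1/2}(E))` then
`0 < Σ_{e∈B} P_{1/2}(e pivotal for E)²`. -/
theorem sum_sq_real_isPivotal_pos {E : Set (BondConfig (Site 2))} (hE : IsUpperSet E)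
    {B : Finset (Sym2 (Site 2))} (hB : (↑B : Set (Sym2 (Site 2))) ⊆ (zdGraph 2).edgeSet)
    (hEB : DeterminedBy E (↑B : Set (Sym2 (Site 2))))
    (h : 0 < (bondPercolation (zdGraph 2) half).real E *
      (1 - (bondPercolation (zdGraph 2) half).real E)) :
    0 < ∑ e ∈ B, (bondPercolation (zdGraph 2) half).real {ω | IsPivotal E e ω} ^ 2 := by
  classical
  have ht : 0 < (bondPercolation (zdGraph 2) half).real E ∧
      0 < 1 - (bondPercolation (zdGraph 2) half).real E :=
    (pos_and_pos_or_neg_and_neg_of_mul_pos h).resolve_right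
      fun h' => absurd h'.1 (not_lt.2 measureReal_nonneg)
  obtain ⟨ω₀, hω₀⟩ : E.Nonempty := nonempty_of_measureReal_ne_zero ht.1.ne'
  obtain ⟨ω₁, hω₁⟩ : Eᶜ.Nonempty := by
    refine nonempty_of_measureReal_ne_zero (μ := bondPercolation (zdGraph 2) half) ?_
    rw [probReal_compl_eq_one_sub hEB.measurableSet_of_finset]
    exact ht.2.ne'
  have hdet := (determinedBy_iff _ _).1 hEB
  have hD : (↑(B.filter (· ∈ ω₀)) : Set (Sym2 (Site 2))) ∈ E := by
    refine (hdet _ ω₀ ?_).2 hω₀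
    ext i
    simp only [Set.mem_inter_iff, Finset.mem_coe, Finset.mem_filter]
    tauto
  have hS : ω₁ ∩ ↑B ∉ E := by
    intro h'
    refine hω₁ ((hdet _ _ ?_).1 h')
    rw [Set.inter_assoc, Set.inter_self]
  have hSD : ω₁ ∩ ↑B ∪ ↑(B.filter (· ∈ ω₀)) ∈ E := hE Set.subset_union_right hD
  obtain ⟨T, e, heD, -, heT, hTB, heTB⟩ :=
    exists_insert_mem_of_union_mem (B.filter (· ∈ ω₀)) (ω₁ ∩ ↑B) hS hSD
  have heB : e ∈ B := (Finset.mem_filter.1 heD).1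
  have hsub : localCylinder (↑(B.erase e) : Set (Sym2 (Site 2))) T ⊆ {ω | IsPivotal E e ω} := by
    intro ω hω
    have hω' : ∀ i ∈ B, i ≠ e → (i ∈ ω ↔ i ∈ T) := fun i hi hie =>
      hω i (by rw [Finset.coe_erase]; exact ⟨Finset.mem_coe.2 hi, hie⟩)
    have h1 : insert e ω ∩ ↑B = insert e T ∩ ↑B := by
      ext i
      simp only [Set.mem_inter_iff, Set.mem_insert_iff, Finset.mem_coe]
      by_cases hie : i = e
      · simp only [hie, true_or, true_and]
      · constructor
        · rintro ⟨hi, hiw⟩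
          exact ⟨Or.inr ((hω' i hiw hie).1 (hi.resolve_left hie)), hiw⟩
        · rintro ⟨hi, hiw⟩
          exact ⟨Or.inr ((hω' i hiw hie).2 (hi.resolve_left hie)), hiw⟩
    have h2 : (ω \ {e}) ∩ ↑B = T ∩ ↑B := by
      ext i
      simp only [Set.mem_inter_iff, Set.mem_sdiff, Set.mem_singleton_iff, Finset.mem_coe]
      constructor
      · rintro ⟨⟨hi, hie⟩, hiw⟩
        exact ⟨(hω' i hiw hie).1 hi, hiw⟩
      · rintro ⟨hi, hiw⟩
        have hie : i ≠ e := fun h => heT (h ▸ hi)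
        exact ⟨⟨(hω' i hiw hie).2 hi, hie⟩, hiw⟩
    show IsPivotal E e ω
    exact Or.inl ⟨(hdet _ _ h1).2 heTB, fun h => hTB ((hdet _ _ h2).1 h)⟩
  have hKE : (↑(B.erase e) : Set (Sym2 (Site 2))) ⊆ (zdGraph 2).edgeSet := fun x hx =>
    hB (Finset.mem_coe.2 (Finset.mem_of_mem_erase (Finset.mem_coe.1 hx)))
  have hpiv : 0 < (bondPercolation (zdGraph 2) half).real {ω | IsPivotal E e ω} :=
    (bondPercolation_half_real_localCylinder_pos hKE T).trans_le (measureReal_mono hsub)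
  exact Finset.sum_pos' (fun i _ => sq_nonneg _) ⟨e, heB, pow_pos hpiv 2⟩

/-! ## Sections of `Aloc` given a layer configuration -/

/-- The section `{ω | (ω ∖ L) ∪ ξ ∈ Aloc}` is increasing. -/
theorem isUpperSet_section (m : ℕ) (F : Fin m → Quad (Set.univ : Set ℂ)) (η : ℝ)
    (L ξ : Set (Sym2 (Site 2))) : IsUpperSet {ω : BondConfig (Site 2) | ω \ L ∪ ξ ∈ Aloc m F η} :=
  fun _ _ hle hω => isUpperSet_Aloc m F η
    (Set.union_subset_union_left _ (Set.sdiff_subset_sdiff_left hle)) hω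

/-- The section `{ω | (ω ∖ L) ∪ ξ ∈ Aloc}` (`ξ ⊆ L ⊆ W`, `W` the window) is determined by the
bulk `W ∖ L`. -/
theorem determinedBy_section (m : ℕ) (F : Fin m → Quad (Set.univ : Set ℂ)) (η : ℝ)
    {W : Finset (Sym2 (Site 2))} (L ξ : Finset (Sym2 (Site 2)))
    (hW : (↑W : Set (Sym2 (Site 2))) = window m F η) :
    DeterminedBy {ω : BondConfig (Site 2) | ω \ ↑L ∪ ↑ξ ∈ Aloc m F η}
      (↑(W \ L) : Set (Sym2 (Site 2))) := by
  rw [determinedBy_iff]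
  intro ω ω' h
  refine mem_Aloc_iff_of_inter_window_eq m F η ?_
  rw [← hW]
  ext i
  have hi := Set.ext_iff.1 h i
  simp only [Set.mem_inter_iff, Finset.coe_sdiff, Set.mem_sdiff, Finset.mem_coe] at hi
  simp only [Set.mem_inter_iff, Set.mem_union, Set.mem_sdiff, Finset.mem_coe]
  constructor
  · rintro ⟨hm | hm, hiW⟩
    · exact ⟨Or.inl ⟨(hi.1 ⟨hm.1, hiW, hm.2⟩).1, hm.2⟩, hiW⟩
    · exact ⟨Or.inr hm, hiW⟩
  · rintro ⟨hm | hm, hiW⟩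
    · exact ⟨Or.inl ⟨(hi.2 ⟨hm.1, hiW, hm.2⟩).1, hm.2⟩, hiW⟩
    · exact ⟨Or.inr hm, hiW⟩

/-- The section is measurable. -/
theorem measurableSet_section (m : ℕ) (F : Fin m → Quad (Set.univ : Set ℂ)) (η : ℝ)
    {W : Finset (Sym2 (Site 2))} (L ξ : Finset (Sym2 (Site 2)))
    (hW : (↑W : Set (Sym2 (Site 2))) = window m F η) :
    MeasurableSet {ω : BondConfig (Site 2) | ω \ ↑L ∪ ↑ξ ∈ Aloc m F η} :=
  (determinedBy_section m F η L ξ hW).measurableSet_of_finset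

/-- **Pivotality for the section = pivotality for `Aloc` at the modified configuration**
(`e ∉ L`, `ξ ⊆ L`). -/
theorem isPivotal_section_iff (m : ℕ) (F : Fin m → Quad (Set.univ : Set ℂ)) (η : ℝ)
    {L ξ : Finset (Sym2 (Site 2))} (hξ : ξ ⊆ L) {e : Sym2 (Site 2)} (he : e ∉ L)
    (ω : BondConfig (Site 2)) :
    IsPivotal {ω' : BondConfig (Site 2) | ω' \ ↑L ∪ ↑ξ ∈ Aloc m F η} e ω ↔
      IsPivotal (Aloc m F η) e (ω \ ↑L ∪ ↑ξ) := by
  have heξ : e ∉ ξ := fun h => he (hξ h)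
  have h1 : insert e ω \ ↑L ∪ ↑ξ = insert e (ω \ ↑L ∪ ↑ξ) := by
    ext f
    simp only [Set.mem_union, Set.mem_sdiff, Set.mem_insert_iff, Finset.mem_coe]
    by_cases hf : f = e
    · subst hf; simp only [true_or, he, not_false_eq_true, and_self]
    · simp only [hf, false_or]
  have h2 : (ω \ {e}) \ ↑L ∪ ↑ξ = (ω \ ↑L ∪ ↑ξ) \ {e} := by
    ext f
    simp only [Set.mem_union, Set.mem_sdiff, Set.mem_singleton_iff, Finset.mem_coe]
    by_cases hf : f = e
    · subst hf
      simp only [not_true_eq_false, and_false, false_and, false_or, heξ]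
    · simp only [hf, not_false_eq_true, and_true]
  simp only [IsPivotal, Set.mem_setOf_eq, h1, h2]

/-- **Disintegration along the layer.**  For `e ∉ L`:
`P(e pivotal for Aloc) = Σ_{ξ ⊆ L} P(ω ∩ L = ξ) · P(e pivotal for the section at ξ)`. -/
theorem real_isPivotal_eq_sum_powerset (m : ℕ) (F : Fin m → Quad (Set.univ : Set ℂ)) {η : ℝ}
    (hη : η ≠ 0) (L : Finset (Sym2 (Site 2))) {e : Sym2 (Site 2)} (he : e ∉ L) :
    (bondPercolation (zdGraph 2) half).real {ω | IsPivotal (Aloc m F η) e ω} =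
      ∑ ξ ∈ L.powerset, (bondPercolation (zdGraph 2) half).real {ω | obs ω L = ξ} *
        (bondPercolation (zdGraph 2) half).real
          {ω | IsPivotal {ω' : BondConfig (Site 2) | ω' \ ↑L ∪ ↑ξ ∈ Aloc m F η} e ω} := by
  have hmeas : MeasurableSet {ω : BondConfig (Site 2) | IsPivotal (Aloc m F η) e ω} :=
    measurableSet_setOf_isPivotal (measurableSet_Aloc m F hη) e
  have h := integral_eq_sum_powerset (zdGraph 2) half L
    (F := fun ω => ({ω | IsPivotal (Aloc m F η) e ω} : Set (BondConfig (Site 2))).indicator 1 ω)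
    (measurable_one.indicator hmeas) (K := 1) (fun ω => by
      by_cases hω : ω ∈ ({ω | IsPivotal (Aloc m F η) e ω} : Set (BondConfig (Site 2)))
      · rw [Set.indicator_of_mem hω, Pi.one_apply, abs_one]
      · rw [Set.indicator_of_notMem hω, abs_zero]
        exact zero_le_one)
  rw [integral_indicator_one hmeas] at h
  rw [h]
  refine Finset.sum_congr rfl fun ξ hξ => ?_
  have hξL : ξ ⊆ L := Finset.mem_powerset.1 hξ
  have hmeasξ : MeasurableSet
      {ω | IsPivotal {ω' : BondConfig (Site 2) | ω' \ ↑L ∪ ↑ξ ∈ Aloc m F η} e ω} := by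
    obtain ⟨W', hW'⟩ := (window_finite m F hη).exists_finset_coe
    exact measurableSet_setOf_isPivotal (measurableSet_section m F η L ξ hW') e
  congr 1
  have hfun : (fun ω : BondConfig (Site 2) =>
      ({ω | IsPivotal (Aloc m F η) e ω} : Set (BondConfig (Site 2))).indicator
        (1 : BondConfig (Site 2) → ℝ) (ω \ ↑L ∪ ↑ξ)) =
      ({ω | IsPivotal {ω' : BondConfig (Site 2) | ω' \ ↑L ∪ ↑ξ ∈ Aloc m F η} e ω} :
        Set (BondConfig (Site 2))).indicator 1 := by
    funext ω
    by_cases hω : IsPivotal (Aloc m F η) e (ω \ ↑L ∪ ↑ξ)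
    · rw [Set.indicator_of_mem (show ω \ ↑L ∪ ↑ξ ∈
          ({ω | IsPivotal (Aloc m F η) e ω} : Set (BondConfig (Site 2))) from hω),
        Set.indicator_of_mem (show ω ∈ ({ω | IsPivotal {ω' : BondConfig (Site 2) |
          ω' \ ↑L ∪ ↑ξ ∈ Aloc m F η} e ω} : Set (BondConfig (Site 2))) from
          (isPivotal_section_iff m F η hξL he ω).2 hω), Pi.one_apply, Pi.one_apply]
    · rw [Set.indicator_of_notMem (show ω \ ↑L ∪ ↑ξ ∉
          ({ω | IsPivotal (Aloc m F η) e ω} : Set (BondConfig (Site 2))) from hω),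
        Set.indicator_of_notMem (show ω ∉ ({ω | IsPivotal {ω' : BondConfig (Site 2) |
          ω' \ ↑L ∪ ↑ξ ∈ Aloc m F η} e ω} : Set (BondConfig (Site 2))) from
          fun h' => hω ((isPivotal_section_iff m F η hξL he ω).1 h'))]
  rw [hfun, integral_indicator_one hmeasξ]

end Summit.CriticalPhenomena.CardyFormulaZ2.Theorems.CardySelfRefinement

end
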